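import Mathlib.GroupTheory.Coset.Basic
import Mathlib.Topology.Algebra.InfiniteSum.Constructions
import Mathlib.Analysis.Complex.Basic
import HarnessLib

/-!
# Re-indexing the Siegel–Eisenstein coset sum along a family of representatives (Weil, n° 39 (30))

Topic `NumberTheory/Automorphic`; namespace `Literature.NumberTheory.Automorphic.SiegelEisenstein`.  KERNEL ONLY: theorems over
Mathlib (group quotients, `tsum`); no definition, no named fact, no `sorry`.

THE PRINT. [Weil1965, n° 39 (30), p. 57]: the Eisenstein–Siegel series `E(Φ) = Σ_{γ ∈ P(k)\G(k)} (r(γ)Φ)(0)` — the term depends only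
on the coset because the section `γ ↦ (r(γ)Φ)(0)` is left-`P(k)`-invariant; «dans la pratique» one sums over a chosen system of
representatives of the cosets, e.g. over the Bruhat cells `P(k)\G(k) = {P} ⊔ {P w n(b) : b}` at rank one ([Weil1965, n° 46 p. 66:
`Ps_k = P_k ∪ P_k w N_k` for `n = 1`]; [GelbartRogawski1991, §3]; [Kudla1994, §3]).

THE TREE'S SPELLING (cell `hodgecm-mathlib`, crux H413, E-2 child line `Cruxes/H413/Lines/F0_E2SiegelWeilWeilRange.lean` §1b,
A-p17 (g13)): for a group `R` acting on a space `S` by `act`, subgroups `H, P ≤ R`, and a functional `ev0 : S → ℂ`, the section is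
`eisSection act H P ev0 Ψ q := ev0 (act (q.out : H)⁻¹ Ψ)` on the LEFT cosets `q ∈ H ⧸ (P ⊓ H)` (Mathlib `H ⧸ P.subgroupOf H`; the
inversion turns left cosets into print's right cosets) and `eis … Ψ := ∑' q, eisSection … Ψ q`; the one property used is
`ev0_act_P : ∀ p ∈ P, ∀ Ψ, ev0 (act p Ψ) = ev0 Ψ` (the `SiegelEisensteinCarrier` of the line; at the datum it is ★
`Weil1964.AdelicDoublingOriginValueInvariance`).  A Literature file cannot import a Lines file, so the two in-line definitions are
UNFOLDED to their bodies in every statement below (same convention as ★ `Theorems/H413E2SWDiagonalSeesaw`).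

WHAT IS HERE (generic: any group `R`, any `act` with `act (a * b) = act a ∘ act b`, any additive commutative topological
target `M` for the abstract lemmas, `ℂ` in the named corollaries):
* §1 `apply_act_out_inv_eq` — the term at the coset of `h ∈ H` IS `ev0 (act h⁻¹ Ψ)` (representative independence from `ev0_act_P`);
* §2 `tsum_quotient_eq_tsum_of_bijective` / `summable_quotient_iff_of_bijective` / `hasSum_quotient_iff_of_bijective` — along ANY
  family of representatives `r : X → H` whose cosets exhaust `H ⧸ (P ⊓ H)` bijectively, the Eisenstein sum is `∑' x, ev0 (act (r x)⁻¹ Ψ)`;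
* §3 `hasSum_option_of_summable` / `tsum_option_of_summable` — the `{∞} ⊔ F`-shaped index (`Option`): `∑' = (term at none) + ∑'_b`,
  and the packaged rank-one shape `tsum_quotient_eq_add_tsum_of_bijective_option` («`E(Ψ) = f_Ψ(1) + Σ_b f_Ψ((n(b)w)⁻¹)`»).

Cell `hodgecm-mathlib`, P4 ∕ E-2, row (6) SW2-EIS-UNFOLD piece (A) (B-p02 (g18); F0P4-plan (g3) 01:22:19Z (5)); consumers: the
I-STRUCT-E identity `eis Ψ = Ψ^δ(0) + Σ_{β ∈ F} F*_{Ψ^δ}(β)` (pieces (B) big-cell term, (C) Bruhat representatives), F0P2a-p06 (g5)'s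
`Summable` conjunct of `stub_SW2_siegelWeil`.  HC_CM is proved only modulo the printed citations until rung 0 closes — nothing here
bears on it.

## References
* [Weil1965] A. Weil, *Sur la formule de Siegel dans la théorie des groupes classiques*, Acta Math. 113 (1965): n° 39 (30) p. 57
  (the Eisenstein–Siegel series over `P(k)\G(k)`), n° 46 p. 66 (`Ps_k = P_k ∪ P_k w N_k` at rank one).
* [GelbartRogawski1991] S. Gelbart, J. Rogawski, Invent. Math. 105 (1991), §3 (the rank-one Siegel Eisenstein series on `U(1,1)`).
* [Kudla1994] S. S. Kudla, Israel J. Math. 87 (1994) 361–401, §3 (Bruhat cells relative to the Siegel parabolic).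
-/

set_option autoImplicit false

noncomputable section

namespace Literature.NumberTheory.Automorphic.SiegelEisenstein

variable {R : Type*} [Group R] {S : Type*} (act : R → S → S) (H P : Subgroup R) {M : Type*} (ev0 : S → M)

/-! ## §1 The term depends only on the coset -/

/-- **Representative independence.**  If `act` is a left action (`act (a b) = act a ∘ act b`) and `ev0` is invariant under
`act p`, `p ∈ P`, then the Eisenstein term read at Mathlib's chosen representative `(⟦h⟧).out` of the coset of `h ∈ H` modulo
`P ⊓ H` equals the term at `h`: `ev0 (act (⟦h⟧.out)⁻¹ Ψ) = ev0 (act h⁻¹ Ψ)` («`f_Φ(pg) = f_Φ(g)`»). [cite: Weil1965, n° 39 (30) p. 57] -/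
theorem apply_act_out_inv_eq (hmul : ∀ (a b : R) (Ψ : S), act (a * b) Ψ = act a (act b Ψ))
    (hP : ∀ p ∈ P, ∀ Ψ : S, ev0 (act p Ψ) = ev0 Ψ) (Ψ : S) (h : H) :
    ev0 (act ((Quotient.out (QuotientGroup.mk h : H ⧸ P.subgroupOf H) : H) : R)⁻¹ Ψ) = ev0 (act (h : R)⁻¹ Ψ) := by
  obtain ⟨p, hp⟩ := QuotientGroup.mk_out_eq_mul (P.subgroupOf H) h
  rw [hp, Subgroup.coe_mul, mul_inv_rev, hmul]
  exact hP _ (P.inv_mem (Subgroup.mem_subgroupOf.mp p.2)) _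

/-! ## §2 Re-indexing along a bijective family of representatives -/

section Reindex

variable {X : Type*} (r : X → H)

/-- **Re-indexing the Eisenstein sum.**  If `x ↦ ⟦r x⟧` is a bijection `X ≃ H ⧸ (P ⊓ H)` (a complete system of coset
representatives, e.g. the Bruhat cells), then `∑'_{q} ev0 (act q.out⁻¹ Ψ) = ∑'_{x} ev0 (act (r x)⁻¹ Ψ)` — with NO summability
hypothesis (`tsum` is transported along the equivalence). [cite: Weil1965, n° 39 (30) p. 57] [cite: Kudla1994, §3] -/
theorem tsum_quotient_eq_tsum_of_bijective [AddCommMonoid M] [TopologicalSpace M]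
    (hmul : ∀ (a b : R) (Ψ : S), act (a * b) Ψ = act a (act b Ψ)) (hP : ∀ p ∈ P, ∀ Ψ : S, ev0 (act p Ψ) = ev0 Ψ)
    (hr : Function.Bijective fun x => (QuotientGroup.mk (r x) : H ⧸ P.subgroupOf H)) (Ψ : S) :
    ∑' q : H ⧸ P.subgroupOf H, ev0 (act ((Quotient.out q : H) : R)⁻¹ Ψ) = ∑' x, ev0 (act (r x : R)⁻¹ Ψ) := by
  rw [← (Equiv.ofBijective _ hr).tsum_eq]
  refine tsum_congr fun x => ?_
  rw [Equiv.ofBijective_apply]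
  exact apply_act_out_inv_eq act H P ev0 hmul hP Ψ (r x)

/-- The same at the level of `HasSum`. [cite: Weil1965, n° 39 (30) p. 57] -/
theorem hasSum_quotient_iff_of_bijective [AddCommMonoid M] [TopologicalSpace M]
    (hmul : ∀ (a b : R) (Ψ : S), act (a * b) Ψ = act a (act b Ψ)) (hP : ∀ p ∈ P, ∀ Ψ : S, ev0 (act p Ψ) = ev0 Ψ)
    (hr : Function.Bijective fun x => (QuotientGroup.mk (r x) : H ⧸ P.subgroupOf H)) (Ψ : S) (m : M) :
    HasSum (fun q : H ⧸ P.subgroupOf H => ev0 (act ((Quotient.out q : H) : R)⁻¹ Ψ)) m ↔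
      HasSum (fun x => ev0 (act (r x : R)⁻¹ Ψ)) m := by
  rw [← (Equiv.ofBijective _ hr).hasSum_iff]
  refine Iff.of_eq (congrArg (fun f => HasSum f m) (funext fun x => ?_))
  rw [Function.comp_apply, Equiv.ofBijective_apply]
  exact apply_act_out_inv_eq act H P ev0 hmul hP Ψ (r x)

/-- The same at the level of `Summable` (absolute convergence questions transport term by term, e.g. with `ev0 := ‖·‖ ∘ ev0`).
[cite: Weil1965, n° 39 (30) p. 57] -/
theorem summable_quotient_iff_of_bijective [AddCommMonoid M] [TopologicalSpace M]
    (hmul : ∀ (a b : R) (Ψ : S), act (a * b) Ψ = act a (act b Ψ)) (hP : ∀ p ∈ P, ∀ Ψ : S, ev0 (act p Ψ) = ev0 Ψ)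
    (hr : Function.Bijective fun x => (QuotientGroup.mk (r x) : H ⧸ P.subgroupOf H)) (Ψ : S) :
    Summable (fun q : H ⧸ P.subgroupOf H => ev0 (act ((Quotient.out q : H) : R)⁻¹ Ψ)) ↔
      Summable (fun x => ev0 (act (r x : R)⁻¹ Ψ)) :=
  ⟨fun ⟨m, hm⟩ => ⟨m, (hasSum_quotient_iff_of_bijective act H P ev0 r hmul hP hr Ψ m).1 hm⟩,
    fun ⟨m, hm⟩ => ⟨m, (hasSum_quotient_iff_of_bijective act H P ev0 r hmul hP hr Ψ m).2 hm⟩⟩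

end Reindex

/-! ## §3 The rank-one index `{∞} ⊔ F`: sums over `Option` -/

section OptionIndex

variable {N : Type*} [AddCommMonoid N] [TopologicalSpace N] [ContinuousAdd N]

/-- `∑_{x : Option β} g x = g none + ∑_b g (some b)` as a `HasSum` statement, given summability of the `some`-part (transport along
`Option β ≃ β ⊕ PUnit` and Mathlib's `HasSum.sum`). [cite: Weil1965, n° 46 p. 66] -/
theorem hasSum_option_of_summable {β : Type*} (g : Option β → N) (hg : Summable fun b => g (some b)) :
    HasSum g (g none + ∑' b, g (some b)) := by
  let e : Option β ≃ β ⊕ PUnit.{1} := Equiv.optionEquivSumPUnit β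
  have h₁ : HasSum ((g ∘ e.symm) ∘ Sum.inl) (∑' b, g (some b)) := by
    simpa [Function.comp_def, e] using hg.hasSum
  have h₂ : HasSum ((g ∘ e.symm) ∘ Sum.inr) (g none) := by
    have h0 := hasSum_fintype (fun _ : PUnit.{1} => g none)
    rw [Finset.univ_unique, Finset.sum_singleton] at h0
    exact h0
  have h := HasSum.sum h₁ h₂
  rw [add_comm] at h
  exact e.symm.hasSum_iff.mp h

/-- `Summable` over `Option β` iff the `some`-part is (complex-valued; `Summable.comp_injective` needs a complete group).
[cite: Weil1965, n° 46 p. 66] -/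
theorem summable_option_iff {β : Type*} (g : Option β → ℂ) : Summable g ↔ Summable fun b => g (some b) :=
  ⟨fun h => h.comp_injective (Option.some_injective β), fun h => (hasSum_option_of_summable g h).summable⟩

/-- `∑'_{x : Option β} g x = g none + ∑'_b g (some b)` when the `some`-part is summable. [cite: Weil1965, n° 46 p. 66] -/
theorem tsum_option_of_summable [T2Space N] {β : Type*} (g : Option β → N) (hg : Summable fun b => g (some b)) :
    ∑' x, g x = g none + ∑' b, g (some b) :=
  (hasSum_option_of_summable g hg).tsum_eq

/-- **Rank-one shape of the Eisenstein sum** («`Ps_k = P_k ∪ P_k w N_k`»): if `{1} ⊔ {r b : b}` is a complete system of coset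
representatives (`x ↦ ⟦x.elim 1 r⟧` bijective on `Option β`) and the cell terms `b ↦ ev0 (act (r b)⁻¹ Ψ)` are summable, then
`∑'_q ev0 (act q.out⁻¹ Ψ) = ev0 (act 1 Ψ) + ∑'_b ev0 (act (r b)⁻¹ Ψ)`. [cite: Weil1965, n° 39 (30) p. 57] [cite: Weil1965, n° 46 p. 66] -/
theorem tsum_quotient_eq_add_tsum_of_bijective_option (ev0 : S → ℂ) {β : Type*} (r : β → H)
    (hmul : ∀ (a b : R) (Ψ : S), act (a * b) Ψ = act a (act b Ψ)) (hP : ∀ p ∈ P, ∀ Ψ : S, ev0 (act p Ψ) = ev0 Ψ)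
    (hr : Function.Bijective fun x : Option β => (QuotientGroup.mk (x.elim 1 r) : H ⧸ P.subgroupOf H)) (Ψ : S)
    (hs : Summable fun b => ev0 (act (r b : R)⁻¹ Ψ)) :
    ∑' q : H ⧸ P.subgroupOf H, ev0 (act ((Quotient.out q : H) : R)⁻¹ Ψ) = ev0 (act 1 Ψ) + ∑' b, ev0 (act (r b : R)⁻¹ Ψ) := by
  rw [tsum_quotient_eq_tsum_of_bijective act H P ev0 (fun x : Option β => x.elim 1 r) hmul hP hr Ψ,
    tsum_option_of_summable (fun x : Option β => ev0 (act ((x.elim 1 r : H) : R)⁻¹ Ψ)) hs]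
  simp only [Option.elim_none, Option.elim_some, OneMemClass.coe_one, inv_one]

/-- … and the Eisenstein sum is summable iff the cell terms are. [cite: Weil1965, n° 39 (30) p. 57] [cite: Weil1965, n° 46 p. 66] -/
theorem summable_quotient_iff_of_bijective_option (ev0 : S → ℂ) {β : Type*} (r : β → H)
    (hmul : ∀ (a b : R) (Ψ : S), act (a * b) Ψ = act a (act b Ψ)) (hP : ∀ p ∈ P, ∀ Ψ : S, ev0 (act p Ψ) = ev0 Ψ)
    (hr : Function.Bijective fun x : Option β => (QuotientGroup.mk (x.elim 1 r) : H ⧸ P.subgroupOf H)) (Ψ : S) :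
    Summable (fun q : H ⧸ P.subgroupOf H => ev0 (act ((Quotient.out q : H) : R)⁻¹ Ψ)) ↔
      Summable fun b => ev0 (act (r b : R)⁻¹ Ψ) := by
  rw [summable_quotient_iff_of_bijective act H P ev0 (fun x : Option β => x.elim 1 r) hmul hP hr Ψ]
  exact summable_option_iff (fun x : Option β => ev0 (act ((x.elim 1 r : H) : R)⁻¹ Ψ))

end OptionIndex

end Literature.NumberTheory.Automorphic.SiegelEisenstein

end
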